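import Mathlib
import HarnessLib

/-!
# Crux K2 `PoloidalWindowRigidity` (stmt-NavierStokesRegularity-19708), line `z_shock` — FUNCTIONAL DEPENDENCE ⇒ PARALLEL GRADIENTS
# (the class-free core of lemma L0(a) «globalisation of the local autonomy clause» for the deciding stub `stub_zShockThickAut`)

`--supports stmt-NavierStokesRegularity-19708 --as helper` (leafhand-ns-poloidalwindowdoor-1 g0, 2026-08-30).  Class-free calculus,
Mathlib only.  **No stub and no summit is closed by this file; Navier–Stokes regularity is NOT proved here.**

The deciding stub `stub_zShockThickAut` of `Cruxes/PoloidalWindowRigidity/Lines/z_shock.lean` carries the LOCAL autonomy clause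
`∃ g W₁ ∋ z₀, ∀ z ∈ W₁, ∀ b ≠ 2, ∂_z v_b = g(t, v₂)·∂_b v₂` — the slope `Λ_b := ∂_z v_b / ∂_b v₂` is, near `z₀`, SOME function `g` of
the height velocity `w = v₂`, with NO regularity assumed on `g`.  The card's first lemma L0(a) (§«First lemma of R3», price P1′ of
idea-crit-7) rewrites the clause WITHOUT `g` as the analytic identity
`D_b := (∂_b w·∇(∂_z v_b) − ∂_z v_b·∇(∂_b w)) × ∇w = 0` on the window slice, so that the identity theorem can globalise it along the
analytic slice.  The only non-formal step is: *a differentiable function that is locally SOME function of `w` has gradient parallel to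
`∇w` wherever `∇w ≠ 0`* — `g` need not be differentiable, or even continuous, a priori.  This file proves exactly that, for real
functions on any real normed space:

* `exists_hasFDerivAt_smul_of_eventuallyEq_comp` — if `w` is strictly differentiable at `y` with `Dw(y)e ≠ 0` for some direction `e`,
  `Λ` is differentiable at `y` and `Λ = g ∘ w` near `y` for some `g : ℝ → ℝ`, then `DΛ(y) = c·Dw(y)` for some `c : ℝ`.
  Proof: restrict `w` to the line `y + se`; by the one-dimensional inverse function theorem (`HasStrictDerivAt.localInverse`) it has a
  local inverse `φ` near `w(y)`, and `G := Λ(y + φ(·)e)` is a differentiable function which AGREES WITH `g` near `w(y)`; hence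
  `Λ = G ∘ w` near `y` and the chain rule gives `DΛ(y) = G'(w(y))·Dw(y)`.
* `exists_sub_smul_eq_smul_of_eventuallyEq_mul` — the CLEARED-DENOMINATOR form used by L0(a): if `N = g(w)·D` near `y` with
  `D(y) ≠ 0`, then `D(y)·DN(y) − N(y)·DD(y) = c·Dw(y)` (so every `2 × 2` minor of the pair `(D(y)·DN(y) − N(y)·DD(y), Dw(y))`
  vanishes: `minor_eq_zero_of_eq_smul`).  With `N = ∂_z v_b`, `D = ∂_b w` this is `D_b(y) × ∇w(y) = 0` at every point of the
  autonomy window where `∂_b w ≠ 0` (there `e := e_b` serves as the direction).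

presearch: «functional dependence, Jacobian rank one, gradients parallel, f = g∘h locally» → Mathlib has the inverse function theorem
(`HasStrictDerivAt.localInverse`, `HasStrictFDerivAt.localInverse`) but no functional-dependence lemma; tree `lean search
'parallel.*fderiv|eq_smul_fderiv'` → none relevant. [folklore]
-/

noncomputable section

namespace Summit.NavierStokesRegularity.NavierStokesRegularity.Theorems.PoloidalWindowDoorPoloidalWindowRigidityZShockSlopeFunctionParallel

-- the problem directory repeats the summit name (`NavierStokesRegularity/NavierStokesRegularity`)
set_option linter.dupNamespace false

open Set Filter Topology

variable {E : Type*} [NormedAddCommGroup E] [NormedSpace ℝ E]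

/-- **Functional dependence forces parallel derivatives.**  Let `w, Λ : E → ℝ` on a real normed space, `w` strictly differentiable at
`y` with derivative `w'` and `w' e ≠ 0` for some direction `e`, `Λ` differentiable at `y`, and suppose `Λ = g ∘ w` on a neighbourhood
of `y` for SOME function `g : ℝ → ℝ` (no regularity assumed).  Then `Λ` has derivative `c • w'` at `y` for some real `c`. [folklore] -/
theorem exists_hasFDerivAt_smul_of_eventuallyEq_comp {Λ w : E → ℝ} {g : ℝ → ℝ} {w' : E →L[ℝ] ℝ} {y e : E}
    (hw : HasStrictFDerivAt w w' y) (he : w' e ≠ 0) (hΛ : DifferentiableAt ℝ Λ y)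
    (hloc : ∀ᶠ x in 𝓝 y, Λ x = g (w x)) :
    ∃ c : ℝ, HasFDerivAt Λ (c • w') y := by
  -- the line through `y` in direction `e` and the restriction `ψ` of `w` to it
  set γ : ℝ → E := fun s => y + s • e with hγ
  have hγ0 : γ 0 = y := by simp [hγ]
  have hγd : ∀ s, HasStrictDerivAt γ e s := fun s => by
    have h := ((hasStrictDerivAt_id s).smul_const e).const_add y
    simpa [hγ] using h
  have hγc : Continuous γ := continuous_const.add (continuous_id.smul continuous_const)
  set ψ : ℝ → ℝ := fun s => w (γ s) with hψ
  have hψd : HasStrictDerivAt ψ (w' e) 0 :=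
    HasStrictFDerivAt.comp_hasStrictDerivAt_of_eq 0 hw (hγd 0) hγ0.symm
  have hψ0 : ψ 0 = w y := by simp [hψ, hγ0]
  -- the local inverse `φ` of `ψ` at `0` (one-dimensional inverse function theorem)
  set φ : ℝ → ℝ := hψd.localInverse ψ (w' e) 0 he with hφ
  have hφright : ∀ᶠ c in 𝓝 (ψ 0), ψ (φ c) = c := hψd.eventually_right_inverse he
  have hφ0 : φ (ψ 0) = 0 := (hψd.eventually_left_inverse he).self_of_nhds
  have hφd : HasStrictDerivAt φ (w' e)⁻¹ (ψ 0) := hψd.to_localInverse he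
  -- the differentiable representative `G` of `g` near `w y`
  set G : ℝ → ℝ := fun c => Λ (γ (φ c)) with hG
  have hlim : Tendsto (fun c => γ (φ c)) (𝓝 (w y)) (𝓝 y) := by
    have h : Tendsto (fun c => γ (φ c)) (𝓝 (ψ 0)) (𝓝 (γ (φ (ψ 0)))) :=
      (hγc.continuousAt.tendsto).comp hφd.hasDerivAt.continuousAt
    rwa [hφ0, hγ0, hψ0] at h
  have hGg : ∀ᶠ c in 𝓝 (w y), G c = g c := by
    have h1 : ∀ᶠ c in 𝓝 (w y), ψ (φ c) = c := by rw [← hψ0]; exact hφright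
    have h2 : ∀ᶠ c in 𝓝 (w y), Λ (γ (φ c)) = g (w (γ (φ c))) := hlim.eventually hloc
    filter_upwards [h1, h2] with c hc1 hc2
    have hc1' : w (γ (φ c)) = c := hc1
    simp only [hG, hc2, hc1']
  -- `Λ = G ∘ w` near `y`
  have hΛG : ∀ᶠ x in 𝓝 y, Λ x = G (w x) := by
    have h3 : ∀ᶠ x in 𝓝 y, G (w x) = g (w x) := hw.continuousAt.tendsto.eventually hGg
    filter_upwards [hloc, h3] with x hx hx'
    rw [hx, hx']
  -- `G` is differentiable at `w y`, and the chain rule concludes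
  have hGd : DifferentiableAt ℝ G (w y) := by
    have hΛ' : DifferentiableAt ℝ Λ (γ (φ (w y))) := by rw [← hψ0, hφ0, hγ0]; exact hΛ
    have hφd' : DifferentiableAt ℝ φ (w y) := by rw [← hψ0]; exact hφd.hasDerivAt.differentiableAt
    have hγφ : DifferentiableAt ℝ (fun c => γ (φ c)) (w y) :=
      (hγd (φ (w y))).hasDerivAt.differentiableAt.comp (w y) hφd'
    exact hΛ'.comp (w y) hγφ
  refine ⟨deriv G (w y), ?_⟩
  have hcomp : HasFDerivAt (fun x => G (w x)) (deriv G (w y) • w') y :=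
    hGd.hasDerivAt.comp_hasFDerivAt y hw.hasFDerivAt
  exact hcomp.congr_of_eventuallyEq hΛG

/-- **`fderiv` form.**  Under the hypotheses of `exists_hasFDerivAt_smul_of_eventuallyEq_comp`, `fderiv ℝ Λ y = c • w'` for some
`c : ℝ`. [folklore] -/
theorem exists_fderiv_eq_smul_of_eventuallyEq_comp {Λ w : E → ℝ} {g : ℝ → ℝ} {w' : E →L[ℝ] ℝ} {y e : E}
    (hw : HasStrictFDerivAt w w' y) (he : w' e ≠ 0) (hΛ : DifferentiableAt ℝ Λ y)
    (hloc : ∀ᶠ x in 𝓝 y, Λ x = g (w x)) :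
    ∃ c : ℝ, fderiv ℝ Λ y = c • w' := by
  obtain ⟨c, hc⟩ := exists_hasFDerivAt_smul_of_eventuallyEq_comp hw he hΛ hloc
  exact ⟨c, hc.fderiv⟩

/-- **Cleared-denominator form (the `D_b` of lemma L0(a)).**  If `N, D : E → ℝ` are differentiable at `y` with `D y ≠ 0`, `w` is
strictly differentiable at `y` with `w' e ≠ 0`, and `N = g(w)·D` on a neighbourhood of `y` for SOME `g : ℝ → ℝ`, then
`D(y)·DN(y) − N(y)·DD(y) = c·Dw(y)` for some `c : ℝ` (apply the previous lemma to the slope `Λ := N·D⁻¹`, then the product rule to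
`N = Λ·D`).  For `N = ∂_z v_b`, `D = ∂_b v₂`, `w = v₂`, `e = e_b` this is the pointwise identity `D_b × ∇v₂ = 0` of the card. [folklore] -/
theorem exists_sub_smul_eq_smul_of_eventuallyEq_mul {N D w : E → ℝ} {g : ℝ → ℝ} {w' : E →L[ℝ] ℝ} {y e : E}
    (hw : HasStrictFDerivAt w w' y) (he : w' e ≠ 0) (hN : DifferentiableAt ℝ N y) (hD : DifferentiableAt ℝ D y)
    (hDy : D y ≠ 0) (hloc : ∀ᶠ x in 𝓝 y, N x = g (w x) * D x) :
    ∃ c : ℝ, D y • fderiv ℝ N y - N y • fderiv ℝ D y = c • w' := by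
  -- `D ≠ 0` near `y`
  have hDne : ∀ᶠ x in 𝓝 y, D x ≠ 0 := hD.continuousAt.eventually_ne hDy
  -- the slope `Λ = N / D` is `g ∘ w` near `y`
  set Λ : E → ℝ := fun x => N x * (D x)⁻¹ with hΛdef
  have hΛloc : ∀ᶠ x in 𝓝 y, Λ x = g (w x) := by
    filter_upwards [hloc, hDne] with x hx hx0
    simp only [hΛdef, hx, mul_inv_cancel_right₀ hx0]
  have hΛ : DifferentiableAt ℝ Λ y := hN.mul (hD.inv hDy)
  obtain ⟨c, hc⟩ := exists_hasFDerivAt_smul_of_eventuallyEq_comp hw he hΛ hΛloc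
  -- product rule for `N = Λ · D` near `y`
  have hNΛD : ∀ᶠ x in 𝓝 y, N x = Λ x * D x := by
    filter_upwards [hDne] with x hx0
    simp only [hΛdef, inv_mul_cancel_right₀ hx0]
  have hprod : HasFDerivAt (fun x => Λ x * D x) (Λ y • fderiv ℝ D y + D y • (c • w')) y :=
    hc.mul hD.hasFDerivAt
  have hNd : HasFDerivAt N (Λ y • fderiv ℝ D y + D y • (c • w')) y := hprod.congr_of_eventuallyEq hNΛD
  have hNy : N y = Λ y * D y := hNΛD.self_of_nhds
  refine ⟨D y ^ 2 * c, ?_⟩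
  rw [hNd.fderiv, hNy]
  ext v
  simp only [sub_apply, smul_apply, add_apply, smul_eq_mul]
  ring

/-- **Parallel ⇒ all `2 × 2` minors vanish** (the cross-product reading `A × B = 0` of `A = c • B`, coordinate-free). [folklore] -/
theorem minor_eq_zero_of_eq_smul {A B : E →L[ℝ] ℝ} {c : ℝ} (h : A = c • B) (u v : E) :
    A u * B v - A v * B u = 0 := by
  subst h
  simp only [smul_apply, smul_eq_mul]
  ring

end Summit.NavierStokesRegularity.NavierStokesRegularity.Theorems.PoloidalWindowDoorPoloidalWindowRigidityZShockSlopeFunctionParallel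

end
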